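import Summits.ResolutionOfSingularities.ResolutionOfSingularities.Theorems.EquisingularLiftEquisingularLiftNatThreePointsCI
import HarnessLib

/-!
# [OURS · L1 W4.5(b) · EL♮(3) · D3-9′ «CI3», file 2] `(f, g)` IS RADICAL — the ideal of the four reduced points

Sequel to ✓ `…NatThreePointsCI` (res-type-027 g20; desk R40): with `f = X₀(X₀−1)`, `g = X₁(X₁−1+2X₀)` the ideal `(f, g) ⊆ k[X₀, X₁]` is RADICAL
(`isRadical_span_fg`), equivalently `k[X₀, X₁] ⧸ (f, g)` is reduced — the input for «on the plane chart of the `s`-vertex chart the vanishing ideal of the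
union of the three Steiner lines (= `π⁻¹{(0,0),(1,0),(0,1)}` on `D(ℓ)`) is generated by the pulled-back `f, g`» (vanishing ideal of a zero locus =
radical of the cutting ideal).  Pure commutative algebra; def-free; no `sorry`; standard axioms.  OURS; not a statement of any manuscript; nothing of
[Hironaka2017] asserted; AI-written, weaker than expert review.  `--supports stmt-ResolutionOfSingularities-20148 --as helper`.
References (context only): Matsumura, *Commutative Ring Theory*, §1 [cite: Matsumura1987].
-/

set_option linter.dupNamespace false -- mandated namespace `Summit.<Summit>.<Problem>` of this single-conjunct summit

noncomputable section

open MvPolynomial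

namespace Summit.ResolutionOfSingularities.ResolutionOfSingularities.Cruxes.EquisingularLiftNat.Sections.ThreePointsCI

variable {k : Type} [Field k]

/-- A polynomial a power of which vanishes at a point vanishes there. [folklore] -/
theorem eval_eq_zero_of_pow_eval_eq_zero {q : Fin 2 → k} {h : MvPolynomial (Fin 2) k} {m : ℕ} (hm : eval q (h ^ m) = 0) : eval q h = 0 := by
  rw [map_pow] at hm
  exact pow_eq_zero_iff'.mp hm |>.1

/-- **`(f, g)` is radical**: a power of `h` in `(f, g)` vanishes at the four points `(0,0), (1,0), (0,1), (1,−1)`, hence so does `h`, hence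
`h ∈ (f, g)` by `mem_span_of_eval_eq_zero`. [folklore; cite: Matsumura1987, §1 (context)] -/
theorem isRadical_span_fg :
    (Ideal.span ({X 0 * (X 0 - 1), X 1 * (X 1 - 1 + 2 * X 0)} : Set (MvPolynomial (Fin 2) k))).IsRadical := by
  intro h hh
  obtain ⟨m, hm⟩ := hh
  have hle : ∀ q : Fin 2 → k, (q = ![0, 0] ∨ q = ![1, 0] ∨ q = ![0, 1]) ∨ q = ![1, -1] → eval q (h ^ m) = 0 := by
    intro q hq
    have hmem : h ^ m ∈ MvPolynomial.vanishingIdeal k {q} := by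
      rcases hq with hq | rfl
      · exact span_le_vanishingIdeal q hq hm
      · -- the spurious point: `f(1,-1) = 0`, `g(1,-1) = 0`
        refine (Ideal.span_le.mpr ?_) hm
        rintro p hp
        simp only [Set.mem_insert_iff, Set.mem_singleton_iff] at hp
        rw [SetLike.mem_coe, MvPolynomial.mem_vanishingIdeal_singleton_iff, MvPolynomial.aeval_eq_eval]
        rcases hp with rfl | rfl <;> norm_num
    rw [MvPolynomial.mem_vanishingIdeal_singleton_iff, MvPolynomial.aeval_eq_eval] at hmem
    exact hmem
  exact mem_span_of_eval_eq_zero h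
    (eval_eq_zero_of_pow_eval_eq_zero (hle _ (Or.inl (Or.inl rfl))))
    (eval_eq_zero_of_pow_eval_eq_zero (hle _ (Or.inl (Or.inr (Or.inl rfl)))))
    (eval_eq_zero_of_pow_eval_eq_zero (hle _ (Or.inl (Or.inr (Or.inr rfl)))))
    (eval_eq_zero_of_pow_eval_eq_zero (hle _ (Or.inr rfl)))

/-- … equivalently `k[X₀, X₁] ⧸ (f, g)` is reduced. [folklore] -/
theorem isReduced_quotient_span_fg :
    IsReduced (MvPolynomial (Fin 2) k ⧸ Ideal.span ({X 0 * (X 0 - 1), X 1 * (X 1 - 1 + 2 * X 0)} : Set (MvPolynomial (Fin 2) k))) :=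
  (Ideal.isRadical_iff_quotient_reduced _).mp isRadical_span_fg

end Summit.ResolutionOfSingularities.ResolutionOfSingularities.Cruxes.EquisingularLiftNat.Sections.ThreePointsCI

end
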